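import Summits.HubbardSuperconductivity.HubbardSuperconductivity.Theorems.AnisotropyChordInsertionEntropyRoute

/-!
# Route `AnisotropyChord` / H0 rotor rung: the entropy route — the J-DIVERGENCE form (`KL ≤ J`), the
# vacancy-conditioned reference law, E-FLOOR-J, the one-body reduction of `J`, LEMMA M, and the J-form
# crux `InsertionJBound` with its proved link `E_J ⇒ E` (theory seat memo ROTOR-THEORY-7 §91–§93;
# Sketch7 Part D transplanted verbatim up to namespace and docstring tags)

* `jDiv` (Jeffreys), `klDiv_le_jDiv` (Gibbs), `jDiv_eq_of_decomp` (J is linear in the log-ratio);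
  LEMMA M `zerothMoment_ge_gap_mul_invMoment` (`S(k) ≥ ω₀(k)·m₋₁(k)`: the infrared end);
* `vacantLaw` (`π̃_x`), `occ`, `linStat`, `insertionResponse` (`δρ_x`), `klDiv_bornLaw_eq`
  (`KL(ν‖π) = KL(ν‖π̃) − log(1−ρ_M)`), **THEOREM E-FLOOR-J** `condensateDensity_ge_of_jDiv`,
  `jDiv_holeLaw_eq_onebody`;
* crux **E_J** `InsertionJBound` (typed, OPEN) and the PROVED link `insertionEntropyBound_of_jBound`.

Typing authority: theory seat `hubbard-h0-rotor-theory-1`, cycle 7.  Nothing here claims E or E_J.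
-/

set_option linter.dupNamespace false

noncomputable section

open Matrix Finset Real Filter Topology
open Literature.MathematicalPhysics.QuantumLattice Literature.Probability.LatticeModels

namespace Summit.HubbardSuperconductivity.HubbardSuperconductivity.Theorems.AnisotropyChord.InsertionEntropy

/-! ## D. The J-divergence form -/

section EntropyJ

variable {ι : Type*} [Fintype ι]

/-- Jeffreys' symmetrised divergence `J(p,q) = Σ (p − q) log(p/q)` (`= KL(p‖q) + KL(q‖p)` for mutually
absolutely continuous laws). [folklore] -/
def jDiv (p q : ι → ℝ) : ℝ := ∑ i, (p i - q i) * Real.log (p i / q i)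

/-- **`KL ≤ J`** (Gibbs' inequality `KL(q‖p) ≥ 0`, via `log t ≤ t − 1`). [folklore] -/
theorem klDiv_le_jDiv (p q : ι → ℝ) (hp : ∀ i, 0 ≤ p i) (hq : ∀ i, 0 ≤ q i)
    (hp1 : ∑ i, p i = 1) (hq1 : ∑ i, q i = 1) (hac : ∀ i, 0 < q i → 0 < p i) :
    klDiv p q ≤ jDiv p q := by
  have key : ∀ i, q i * Real.log (p i / q i) ≤ p i - q i := by
    intro i
    rcases eq_or_lt_of_le (hq i) with h | h
    · rw [← h]; simp [hp i]
    · have hpi := hac i h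
      have hq0 : q i ≠ 0 := ne_of_gt h
      have hl := Real.log_le_sub_one_of_pos (div_pos hpi h)
      calc q i * Real.log (p i / q i) ≤ q i * (p i / q i - 1) :=
            mul_le_mul_of_nonneg_left hl (le_of_lt h)
        _ = p i - q i := by field_simp
  have hsum : ∑ i, q i * Real.log (p i / q i) ≤ 0 := by
    calc ∑ i, q i * Real.log (p i / q i) ≤ ∑ i, (p i - q i) := Finset.sum_le_sum fun i _ => key i
      _ = 0 := by rw [Finset.sum_sub_distrib, hp1, hq1, sub_self]
  have hsplit : jDiv p q = klDiv p q - ∑ i, q i * Real.log (p i / q i) := by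
    unfold jDiv klDiv
    rw [← Finset.sum_sub_distrib]
    exact Finset.sum_congr rfl fun i _ => by ring
  linarith

/-- **One-body reduction of `J`.**  If `log(p/q) = c + G + R` on the common support, then
`J(p,q) = Σ (p − q)·G + Σ (p − q)·R` — the constant drops out because `Σ p = Σ q`, and `J` is LINEAR
in the log-ratio, so every term of a decomposition contributes additively. (theory seat `hubbard-h0-rotor-theory-1`, memo ROTOR-THEORY-7) [folklore] -/
theorem jDiv_eq_of_decomp (p q G R : ι → ℝ) (c : ℝ) (hq : ∀ i, 0 ≤ q i)
    (hp1 : ∑ i, p i = 1) (hq1 : ∑ i, q i = 1) (hsupp : ∀ i, q i = 0 → p i = 0)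
    (hF : ∀ i, 0 < q i → Real.log (p i / q i) = c + G i + R i) :
    jDiv p q = ∑ i, (p i - q i) * G i + ∑ i, (p i - q i) * R i := by
  unfold jDiv
  have h : ∀ i, (p i - q i) * Real.log (p i / q i)
      = (p i - q i) * c + ((p i - q i) * G i + (p i - q i) * R i) := by
    intro i
    rcases eq_or_lt_of_le (hq i) with h0 | h0
    · have hp0 : p i = 0 := hsupp i h0.symm
      rw [hp0, ← h0]; simp
    · rw [hF i h0]; ring
  rw [Finset.sum_congr rfl fun i _ => h i, Finset.sum_add_distrib, Finset.sum_add_distrib,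
    ← Finset.sum_mul, Finset.sum_sub_distrib, hp1, hq1, sub_self, zero_mul, zero_add]

/-- **LEMMA M (moment inequality; the infrared end of the route).**  For non-negative spectral weights
`w n` at energies `ω n ≥ ω₀ > 0`:  `ω₀ · Σ w/ω ≤ Σ w`.  Read with `w n = |⟨n|ρ_k|0⟩|²/N`:
`S(k) = m₀(k) ≥ ω₀(k) · m₋₁(k) = ½ ω₀(k) χ(k)` — the static structure factor is bounded BELOW by the
density-channel gap times half the static susceptibility; so «compressible (`χ_L(k) ≥ χ₀ > 0`) + Landau
(`ω₀^{(L)}(k) ≥ c_s |k|`)» gives `S_L(k) ≥ ½ χ₀ c_s |k|`, hence `N⁻¹ Σ_{k≠0} S_L(k)⁻¹ = O(1)` in `d = 2`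
(memo §92; saturated to 0.4 % at `k_min` in ED). [folklore] -/
theorem zerothMoment_ge_gap_mul_invMoment {κ : Type*} [Fintype κ] (w ω : κ → ℝ) (ω₀ : ℝ)
    (hω₀ : 0 < ω₀) (hw : ∀ n, 0 ≤ w n) (hω : ∀ n, ω₀ ≤ ω n) :
    ω₀ * ∑ n, w n / ω n ≤ ∑ n, w n := by
  rw [Finset.mul_sum]
  refine Finset.sum_le_sum fun n _ => ?_
  have hωn : 0 < ω n := lt_of_lt_of_le hω₀ (hω n)
  rw [mul_div_assoc', div_le_iff₀ hωn]
  calc ω₀ * w n = w n * ω₀ := mul_comm _ _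
    _ ≤ w n * ω n := mul_le_mul_of_nonneg_left (hω n) (hw n)

end EntropyJ

section LatticeJ

variable {V : Type} [Fintype V] [DecidableEq V]

/-- Law of the reference state CONDITIONED ON `x` VACANT: `π̃_x(τ) = ψ_M(τ)²/(1 − ρ_M(x)) · [x ∉ τ]`.
This (not `π = ψ_M²`) is the law mutually absolutely continuous with the insertion law `ν_x`, and
`KL(ν_x‖π) = KL(ν_x‖π̃_x) − log(1 − ρ_M(x))`. (theory seat `hubbard-h0-rotor-theory-1`, memo ROTOR-THEORY-7) [folklore] -/
def vacantLaw (aM : (V → Fin 2) → ℝ) (x : V) (τ : V → Fin 2) : ℝ :=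
  if τ x = 1 then aM τ ^ 2 / (1 - siteDensity aM x) else 0

/-- Occupation indicator `n_s(τ) = [τ s = 0]`. (theory seat `hubbard-h0-rotor-theory-1`, memo ROTOR-THEORY-7) [folklore] -/
def occ (τ : V → Fin 2) (s : V) : ℝ := if τ s = 0 then 1 else 0

/-- One-body (linear) statistic `G_U(τ) = Σ_s U(s) n_s(τ)`. (theory seat `hubbard-h0-rotor-theory-1`, memo ROTOR-THEORY-7) [folklore] -/
def linStat (U : V → ℝ) (τ : V → Fin 2) : ℝ := ∑ s, U s * occ τ s

/-- INSERTION DENSITY RESPONSE `δρ_x(s) = E_{ν_x} n_s − E_{π̃_x} n_s` (density at `s` seen from a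
particle at `x` minus density seen from a vacancy at `x`): explicit two-point data, on a vertex-transitive
torus `δρ̂_x(k) = S_N(k) − 1 + ρ'_M S_M(k)/(1 − ρ'_M)` for `k ≠ 0` (memo §91, checked to 1e-12). (theory seat `hubbard-h0-rotor-theory-1`, memo ROTOR-THEORY-7) [folklore] -/
def insertionResponse (aM aN : (V → Fin 2) → ℝ) (x s : V) : ℝ :=
  ∑ τ, (holeLaw aN x τ - vacantLaw aM x τ) * occ τ s

/-- The vacancy-conditioned law is non-negative (`ρ_M(x) < 1`). (theory seat `hubbard-h0-rotor-theory-1`, memo ROTOR-THEORY-7) [folklore] -/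
theorem vacantLaw_nonneg (aM : (V → Fin 2) → ℝ) (x : V) (hq : siteDensity aM x < 1) (τ : V → Fin 2) :
    0 ≤ vacantLaw aM x τ := by
  unfold vacantLaw
  split_ifs
  · exact div_nonneg (sq_nonneg _) (le_of_lt (sub_pos.mpr hq))
  · exact le_rfl

/-- The vacancy-conditioned law is a probability law for a normalised reference state (`ρ_M(x) < 1`). (theory seat `hubbard-h0-rotor-theory-1`, memo ROTOR-THEORY-7) [folklore] -/
theorem sum_vacantLaw (aM : (V → Fin 2) → ℝ) (x : V) (hM1 : ∑ τ, aM τ ^ 2 = 1)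
    (hq : siteDensity aM x < 1) : ∑ τ, vacantLaw aM x τ = 1 := by
  have hq' : (1 - siteDensity aM x) ≠ 0 := ne_of_gt (sub_pos.mpr hq)
  have h1 : ∀ τ, vacantLaw aM x τ = (if τ x = 1 then aM τ ^ 2 else 0) / (1 - siteDensity aM x) := by
    intro τ; unfold vacantLaw; split_ifs <;> simp
  rw [Finset.sum_congr rfl fun τ _ => h1 τ, ← Finset.sum_div, div_eq_one_iff_eq hq']
  have h2 : ∀ τ : V → Fin 2, (if τ x = 1 then aM τ ^ 2 else 0)
      = aM τ ^ 2 - (if τ x = 0 then aM τ ^ 2 else 0) := by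
    intro τ
    rcases Fin.eq_zero_or_eq_succ (τ x) with h | ⟨j, hj⟩
    · simp [h]
    · have : τ x = 1 := by rw [hj]; exact congrArg Fin.succ (Fin.eq_zero j)
      simp [this]
  rw [Finset.sum_congr rfl fun τ _ => h2 τ, Finset.sum_sub_distrib, hM1]
  unfold siteDensity
  rfl

/-- `π̃_x ≪ π`: where the vacancy law is positive so is the Born law. (theory seat `hubbard-h0-rotor-theory-1`, memo ROTOR-THEORY-7) [folklore] -/
theorem bornLaw_pos_of_vacantLaw_pos (aM : (V → Fin 2) → ℝ) (x : V) (hq : siteDensity aM x < 1)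
    (τ : V → Fin 2) (h : 0 < vacantLaw aM x τ) : 0 < bornLaw aM τ := by
  unfold vacantLaw at h
  unfold bornLaw
  split_ifs at h with hτ
  · exact (div_pos_iff_of_pos_right (sub_pos.mpr hq)).mp h
  · exact absurd h (lt_irrefl 0)

/-- `KL(ν_x‖π) = KL(ν_x‖π̃_x) − log(1 − ρ_M(x))`. (theory seat `hubbard-h0-rotor-theory-1`, memo ROTOR-THEORY-7) [folklore] -/
theorem klDiv_bornLaw_eq (aM aN : (V → Fin 2) → ℝ) (x : V)
    (hρ : 0 < siteDensity aN x) (hq : siteDensity aM x < 1)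
    (hac : ∀ τ, 0 < holeLaw aN x τ → 0 < bornLaw aM τ) :
    klDiv (holeLaw aN x) (bornLaw aM)
      = klDiv (holeLaw aN x) (vacantLaw aM x) - Real.log (1 - siteDensity aM x) := by
  have hqpos : 0 < 1 - siteDensity aM x := sub_pos.mpr hq
  unfold klDiv
  have h1 : Real.log (1 - siteDensity aM x)
      = ∑ τ, holeLaw aN x τ * Real.log (1 - siteDensity aM x) := by
    rw [← Finset.sum_mul, sum_holeLaw aN x hρ, one_mul]
  rw [h1, ← Finset.sum_sub_distrib]
  refine Finset.sum_congr rfl fun τ _ => ?_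
  rcases eq_or_lt_of_le (holeLaw_nonneg aN x hρ τ) with h | h
  · rw [← h]; simp
  · have hπ : 0 < bornLaw aM τ := hac τ h
    have hτ : τ x = 1 := by
      by_contra hne
      unfold holeLaw at h
      rw [if_neg hne] at h
      exact lt_irrefl 0 h
    have hv : vacantLaw aM x τ = bornLaw aM τ / (1 - siteDensity aM x) := by
      unfold vacantLaw bornLaw; rw [if_pos hτ]
    rw [hv, ← mul_sub]
    congr 1
    rw [Real.log_div (ne_of_gt h) (ne_of_gt hπ), Real.log_div (ne_of_gt h) (ne_of_gt (div_pos hπ hqpos)),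
      Real.log_div (ne_of_gt hπ) (ne_of_gt hqpos)]
    ring

/-- **THEOREM E-FLOOR-J.**  `n₀/|V| ≥ ρ (1 − ρ_M) · exp(−sup_x J(ν_x, π̃_x))`: the condensate density is
bounded below by the density, the reference vacancy density, and the symmetrised insertion entropy —
which is LINEAR in the log insertion ratio (`J = E_{ν_x} F − E_{π̃_x} F`,
`F = log[ψ_N(·+x)²/ψ_M(·)²]`). (theory seat `hubbard-h0-rotor-theory-1`, memo ROTOR-THEORY-7) [folklore] -/
theorem condensateDensity_ge_of_jDiv [Nonempty V] (aM aN : (V → Fin 2) → ℝ) (ρ ρM K : ℝ)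
    (hρ : 0 < ρ) (hρM : ρM < 1) (hM : ∀ τ, 0 ≤ aM τ) (hN : ∀ σ, 0 ≤ aN σ) (hM1 : ∑ τ, aM τ ^ 2 = 1)
    (hdens : ∀ x, siteDensity aN x = ρ) (hdensM : ∀ x, siteDensity aM x = ρM)
    (hac : ∀ x τ, 0 < holeLaw aN x τ ↔ 0 < vacantLaw aM x τ)
    (hK : ∀ x, jDiv (holeLaw aN x) (vacantLaw aM x) ≤ K) :
    ρ * (1 - ρM) * Real.exp (-K) ≤ condensateDensity aN := by
  have hρx : ∀ x, 0 < siteDensity aN x := fun x => by rw [hdens x]; exact hρ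
  have hqx : ∀ x, siteDensity aM x < 1 := fun x => by rw [hdensM x]; exact hρM
  have hac' : ∀ x τ, 0 < holeLaw aN x τ → 0 < bornLaw aM τ :=
    fun x τ h => bornLaw_pos_of_vacantLaw_pos aM x (hqx x) τ ((hac x τ).mp h)
  have hK' : ∀ x, klDiv (holeLaw aN x) (bornLaw aM) ≤ K - Real.log (1 - ρM) := by
    intro x
    rw [klDiv_bornLaw_eq aM aN x (hρx x) (hqx x) (hac' x), hdensM x]
    have := klDiv_le_jDiv (holeLaw aN x) (vacantLaw aM x) (holeLaw_nonneg aN x (hρx x))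
      (vacantLaw_nonneg aM x (hqx x)) (sum_holeLaw aN x (hρx x)) (sum_vacantLaw aM x hM1 (hqx x))
      (fun τ h => (hac x τ).mpr h)
    linarith [hK x]
  have main := condensateDensity_ge_of_entropy aM aN ρ (K - Real.log (1 - ρM)) hρ hM hN hM1 hdens hac' hK'
  have hexp : Real.exp (-(K - Real.log (1 - ρM))) = (1 - ρM) * Real.exp (-K) := by
    rw [neg_sub, sub_eq_add_neg, Real.exp_add, Real.exp_log (sub_pos.mpr hρM)]
  calc ρ * (1 - ρM) * Real.exp (-K) = ρ * Real.exp (-(K - Real.log (1 - ρM))) := by rw [hexp]; ring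
    _ ≤ condensateDensity aN := main

/-- **One-body reduction on the lattice.**  If the log insertion ratio is one-body up to a remainder,
`log(ν_x/π̃_x) = c + Σ_s U(s) n_s + R` on the support, then
`J(ν_x, π̃_x) = Σ_s U(s) δρ_x(s) + (E_{ν_x} − E_{π̃_x}) R`. (theory seat `hubbard-h0-rotor-theory-1`, memo ROTOR-THEORY-7) [folklore] -/
theorem jDiv_holeLaw_eq_onebody (aM aN : (V → Fin 2) → ℝ) (x : V) (U : V → ℝ)
    (R : (V → Fin 2) → ℝ) (c : ℝ) (hρ : 0 < siteDensity aN x) (hM1 : ∑ τ, aM τ ^ 2 = 1)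
    (hq : siteDensity aM x < 1) (hac : ∀ τ, 0 < holeLaw aN x τ ↔ 0 < vacantLaw aM x τ)
    (hF : ∀ τ, 0 < vacantLaw aM x τ →
      Real.log (holeLaw aN x τ / vacantLaw aM x τ) = c + linStat U τ + R τ) :
    jDiv (holeLaw aN x) (vacantLaw aM x)
      = ∑ s, U s * insertionResponse aM aN x s
        + ∑ τ, (holeLaw aN x τ - vacantLaw aM x τ) * R τ := by
  have hsupp : ∀ τ, vacantLaw aM x τ = 0 → holeLaw aN x τ = 0 := by
    intro τ h0
    by_contra hne
    have hpos : 0 < holeLaw aN x τ := lt_of_le_of_ne (holeLaw_nonneg aN x hρ τ) (Ne.symm hne)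
    have := (hac τ).mp hpos
    rw [h0] at this
    exact lt_irrefl 0 this
  rw [jDiv_eq_of_decomp (holeLaw aN x) (vacantLaw aM x) (linStat U) R c (vacantLaw_nonneg aM x hq)
    (sum_holeLaw aN x hρ) (sum_vacantLaw aM x hM1 hq) hsupp hF]
  congr 1
  unfold insertionResponse linStat
  simp_rw [Finset.mul_sum]
  rw [Finset.sum_comm]
  exact Finset.sum_congr rfl fun s _ => Finset.sum_congr rfl fun τ _ => by ring

end LatticeJ

section CruxJ

/-- **CONJECTURE E_J — `InsertionJBound` (J-form of the crux; implies `InsertionEntropyBound` along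
sequences of density bounded away from 1, theorem below).**  Uniformly in `L` (eventually) and in `x`,
`ν_x ∼ π̃_x` and `J(ν_x, π̃_x) ≤ K`.  ED (memo §91): `J/KL_int ∈ [2.00, 2.11]` on tori (Gaussian value 2),
one-body share of `J` ≥ 97 % (100.00 % at `d = 1, Δ = 0`). [conjecture: theory seat hubbard-h0-rotor-theory-1, cycle 7, 2026-08-28 — memo ROTOR-THEORY-7 §91 (J-form of crux E; OPEN)] -/
def InsertionJBound (Δ : ℝ) (M : ℕ → ℝ) : Prop :=
  ∃ K : ℝ, ∀ᶠ L : ℕ in atTop, ∀ [NeZero L],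
    ∀ aN aM : TensorIndex (TorusSite 2 L) 2 → ℝ,
      IsPerronSectorGroundAmplitude L Δ (M L) aN → IsPerronSectorGroundAmplitude L Δ (M L - 1) aM →
        ∀ x : TorusSite 2 L,
          (∀ τ, 0 < holeLaw aN x τ ↔ 0 < vacantLaw aM x τ) ∧ jDiv (holeLaw aN x) (vacantLaw aM x) ≤ K

/-- **LINK (PROVED): `E_J ⇒ E`** given uniform site densities of both sectors, eventually in `(0, ρ')`
with `ρ' < 1`. (theory seat `hubbard-h0-rotor-theory-1`, memo ROTOR-THEORY-7) [folklore] -/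
theorem insertionEntropyBound_of_jBound (Δ : ℝ) (M : ℕ → ℝ) (ρ' : ℝ) (hρ' : ρ' < 1)
    (hJ : InsertionJBound Δ M) (hU : UniformSiteDensity Δ M)
    (hU' : UniformSiteDensity Δ (fun L => M L - 1))
    (hpos : ∀ᶠ L : ℕ in atTop, 0 < 1 / 2 + M L / (L : ℝ) ^ 2)
    (hle : ∀ᶠ L : ℕ in atTop, 1 / 2 + (M L - 1) / (L : ℝ) ^ 2 ≤ ρ') :
    InsertionEntropyBound Δ M := by
  obtain ⟨K, hK⟩ := hJ
  refine ⟨K - Real.log (1 - ρ'), ?_⟩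
  filter_upwards [hK, hU, hU', hpos, hle] with L hKL hUL hUL' hposL hleL
  intro _ aN aM haN haM x
  have hρx : 0 < siteDensity aN x := by rw [hUL aN haN x]; exact hposL
  have hdM : siteDensity aM x = 1 / 2 + (M L - 1) / (L : ℝ) ^ 2 := hUL' aM haM x
  have hqx : siteDensity aM x < 1 := by rw [hdM]; exact lt_of_le_of_lt hleL hρ'
  obtain ⟨hacx, hJx⟩ := hKL aN aM haN haM x
  have hac' : ∀ τ, 0 < holeLaw aN x τ → 0 < bornLaw aM τ :=
    fun τ h => bornLaw_pos_of_vacantLaw_pos aM x hqx τ ((hacx τ).mp h)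
  refine ⟨hac', ?_⟩
  rw [klDiv_bornLaw_eq aM aN x hρx hqx hac']
  have h1 := klDiv_le_jDiv (holeLaw aN x) (vacantLaw aM x) (holeLaw_nonneg aN x hρx)
    (vacantLaw_nonneg aM x hqx) (sum_holeLaw aN x hρx) (sum_vacantLaw aM x haM.unit hqx)
    (fun τ h => (hacx τ).mpr h)
  have h2 : Real.log (1 - ρ') ≤ Real.log (1 - siteDensity aM x) :=
    Real.log_le_log (sub_pos.mpr hρ') (by rw [hdM]; linarith)
  linarith

end CruxJ

end Summit.HubbardSuperconductivity.HubbardSuperconductivity.Theorems.AnisotropyChord.InsertionEntropy
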